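/-
Copyright: statement-level skeleton of a published paper (lit-balaban cell, Phase-2 proof seat p25, gen 20). No proof
claims beyond what the kernel checks below.
-/
import Literature.MathematicalPhysics.QuantumFieldTheory.BalabanImbrieJaffe1984to88.BIJ88WalkRemainderBeatCurrency312
import Literature.MathematicalPhysics.QuantumFieldTheory.BalabanImbrieJaffe1984to88.BIJ88Claim279PkLower

/-!
# `BalabanImbrieJaffe1984to88.BIJ88WalkSmallFactorScales312` — T. Bałaban, J. Imbrie, A. Jaffe, *Effective action and
cluster properties of the abelian Higgs model*, Commun. Math. Phys. **114** (1988) 257–315 [BalabanImbrieJaffe1988],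
§5.14 pp. 309, 310, 312 [PDF 53, 54, 56] with the scales of §2 — **(2.2)** p. 260 *"e_k = (L^kε)^{(4−d)/2}e"*, **(2.3)**
p. 260 *"r(e_k) = |log e_k⁻¹|^r, r > 1"*, **(2.33)** p. 263 *"p(e_k) = |log e_k⁻¹|^p"* (typed by r18 as
`BIJ88Sect2Statements.eK / rLen / pLog`) — and the printed sizes of the two *"extremely small factors"* of the remainder
estimate: p. 310 (x2 render `lit-balaban-r16/renders/cmp114/original-p054-x2.png`, re-read 2026-08-23) *"The others,
localized in region X, have a factor of e^{−cr(e_k)|X|}."* and p. 309 (render `…-p053-x2.png`, re-read 2026-08-23)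
*"and similarly the n-th derivative in t of χ(cp(e_k), A^{(k)}) is bounded by t^{−n} times a function bounded by a
constant and supported in c₁p(te_k) ≦ |A^{(k)}| ≦ c₂p(te_k). After integration over A^{(k)}, we obtain factors
ct^{−n}e^{−cp(te_k)²} ≦ (e^β(L^kε/ε₀)^{1/4−α})^n."*; mechanism sentence p. 278 *"we expect to obtain small factors
exp(−cp(e_k)²) ≦ e_k^κ, for any κ"* (PROVED by p02 as `BIJ88Claim279PkLower.exp_neg_mul_pLog_sq_le_rpow`).

**THE TWO PRINT SENTENCES OF THE BEATING CLAUSE MADE NUMBERS** (p25 gen 20; a MEMBER of row C2.Claim@312: the head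
theorem `BIJ88WalkIneq312RemainderBdry.ineq312_remainder_bdry` (r16 v2.284) is untouched and reached BY NAME through
`BIJ88WalkRemainderBeatCurrency312.ineq312_remainder_bdry_currency`, whose two hypotheses `η_χ ≤ θ_v^M`,
`θ_w ≤ θ_v^M` — its honest-scope line (b): *"print's 'extremely small factors' sentences, NOT derived (they need the
relation between e_k, r(e_k), p(e_k) and L^kε)"* — are DERIVED here from (2.2), (2.3), (2.33) for the printed forms of
the factors: the long-covariance factor `θ_w = K_w e^{−c r(e_k)}` and the `χ′`-factor `η_χ = K_η e^{−c p(e_k)²}`).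

* §1 `exp_neg_mul_rLen_le_rpow`: `r > 1 ⇒ e^{−c r(e_k)} ≤ e_k^κ` for every `κ ≥ 0` once
  `e_k ≤ exp(−(κ/c)^{1/(r−1)})` — the walk analogue of p. 278's `exp(−cp(e_k)²) ≦ e_k^κ`;
* §2 the scale (2.2) against `x = L^kε`: `eK_pos`, `eK_le_sqrt` (`d ≤ 3`, `e ≤ 1`, `L^kε ≤ 1 ⇒ e_k ≤ (L^kε)^{1/2}`),
  `eK_rpow_le` (`e_k^κ ≤ (L^kε)^{κ/2}`), `eK_le_exp_neg`;
* §3 **`walkFactor_le_vertexPow`**: `K_w e^{−c r(e_k)} ≤ (K_v (L^kε)^a)^M` as soon as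
  `L^kε ≤ exp(−2(2(aM+1)/c)^{1/(r−1)})` and `K_w L^kε ≤ K_v^M`;
  **`chiFactor_le_vertexPow`**: `K_η e^{−c p(e_k)²} ≤ (K_v (L^kε)^a)^M` as soon as
  `L^kε ≤ exp(−2(2(aM+1)/c)^{1/(2p−1)})` (`p > 1/2`) and `K_η L^kε ≤ K_v^M`; `pLog_le_pLog_mul_left`,
  `chiFactor_uniform_in_t` (`p(te_k) ≥ p(e_k)` for `0 < t ≤ 1`, so the bound is uniform in the interpolation `t`);
  `eventually_thresholds` (the four thresholds hold for all small `L^kε`);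
* §4 **`ineq312_remainder_bdry_scales`** — the head theorem in print's currency with BOTH sentences discharged: the
  hypotheses of `ineq312_remainder_bdry_currency` with `x := L^kε`, `θ_w := K_w e^{−c_w r(e_k)}`,
  `η_χ := K_η e^{−c_η p(e_k)²}` and, in place of `η_χ ≤ θ_v^M`, `θ_w ≤ θ_v^M`, the four thresholds above.

statement-level skeleton of published theorems with citation tags; proofs where landed; nothing here is a claim
about the Yang–Mills mass gap

PDF held: `paper:balaban1988-cmp114-bij-abelian-higgs-effective-action` (journal page = PDF page + 256); pp. 260, 263
from the text layer (`lit read … --pages 1-12`, 2026-08-23) against r18's verbatim docstrings of `eK`/`rLen`/`pLog`;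
pp. 309, 310 from the x2 renders as quoted.

CITATION HEADER (lean-in-tree rule).  lit-balaban cell (HOME `run/shared/lean/pub/lit-balaban/`), Phase 2, seat p25
gen 20; row **C2.Claim@312** of `HOME/lit-balaban-r16/ROWS-C2-part2.md` (owner r16, referee ref-5; head theorem of
record UNCHANGED; this file is a MEMBER closing honest-scope line (b) of `BIJ88WalkRemainderBeatCurrency312`).  Nothing
restated: `eK`, `rLen`, `pLog` (r18), `exp_neg_mul_pLog_sq_le_rpow` (p02) and the currency theorem are used by name.
HONEST SCOPE: (a) the FORMS `θ_w = K_w e^{−c r(e_k)}` (one region; print's per-region `|X|` in the exponent is the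
head's `θ^{nfree}` bookkeeping, not this factor) and `η_χ = K_η e^{−c p(e_k)²}` are print's stated sizes, TAKEN — their
derivation (random-walk decay of the long covariances; the Gaussian tail on the support of `χ′`) is not here, and
print's `t^{−n}` belongs to the `t`-integrals of (5.14.1)–(5.14.2), not modelled (`p(te_k) ≥ p(e_k)` makes the bound
uniform in `t`); (b) `d ≤ 3` and `e ≤ 1`, `L^kε ≤ 1` (so `e_k ≤ (L^kε)^{1/2}`); (c) thresholds explicit, not optimized;
everything else as in the currency theorem ((a)–(c) there) and the head ((H1)–(H5)).  NOT summit progress; NOT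
continuum; NOT Clay.  Imports `BIJ88WalkRemainderBeatCurrency312` (p25 g20) and `BIJ88Claim279PkLower` (p02); modifies
nothing; 0 `sorry`, 0 definitions, 0 `Prop` facts.
-/

noncomputable section

namespace Literature.MathematicalPhysics.QuantumFieldTheory.BalabanImbrieJaffe1984to88.BIJ88WalkSmallFactorScales312

open Classical MeasureTheory Matrix Finset Filter
open scoped BigOperators Topology
open Literature.MathematicalPhysics.QuantumFieldTheory.Balaban1983to89
open B2Eq228Conditioning (weight source)
open BIJ88PolymerRep5134 (corner)
open BIJ88PolymerRep5134Gauss (prec src)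
open BIJ88SlotMomentsGauss308 (fieldLaw)
open BIJ88VertexIbp311 (vexp)
open BIJ88WickDerivatives305 (dlist)
open BIJ88Sect2Statements (eK rLen pLog)
open BIJ88Claim279PkLower (exp_neg_mul_pLog_sq_le_rpow)
open BIJ88WalkRun311 BIJ88WalkExpansion311 BIJ88WalkRemainderActivity312 BIJ88WalkIneq312Remainder
  BIJ88WalkIneq312RemainderBdry BIJ88WalkRemainderBeatCurrency312

/-! ## §1  `e^{−c r(e_k)}` is below every power of `e_k` -/

section Walk

/-- **the long-covariance factor beats every power of the charge**: with the localization length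
`r(e_k) = |log e_k⁻¹|^r`, `r > 1` ((2.3)), for every `c > 0`, `κ ≥ 0`: `e^{−c r(e_k)} ≤ e_k^κ` as soon as
`e_k ≤ exp(−(κ/c)^{1/(r−1)})` (i.e. `c|log e_k⁻¹|^{r−1} ≥ κ`) — the walk analogue of p. 278's *"exp(−cp(e_k)²) ≦ e_k^κ, for
any κ"*. [cite: BalabanImbrieJaffe1988, (2.3) p.260; §5.14 p.310] -/
theorem exp_neg_mul_rLen_le_rpow {c κ r ek : ℝ} (hc : 0 < c) (hκ : 0 ≤ κ) (hr : 1 < r) (hek : 0 < ek)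
    (hsmall : ek ≤ Real.exp (-((κ / c) ^ (1 / (r - 1))))) :
    Real.exp (-(c * rLen r ek)) ≤ ek ^ κ := by
  -- t = log e_k⁻¹ ≥ t₀ = (κ/c)^{1/(r−1)} ≥ 0
  set t := Real.log ek⁻¹ with ht
  have hq : 0 < r - 1 := by linarith
  have ht0 : 0 ≤ (κ / c) ^ (1 / (r - 1)) := Real.rpow_nonneg (div_nonneg hκ hc.le) _
  have htge : (κ / c) ^ (1 / (r - 1)) ≤ t := by
    have h1 : Real.log ek ≤ -((κ / c) ^ (1 / (r - 1))) := by
      rw [← Real.log_exp (-((κ / c) ^ (1 / (r - 1))))]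
      exact Real.log_le_log hek hsmall
    rw [ht, Real.log_inv]; linarith
  have htnn : 0 ≤ t := ht0.trans htge
  have hrLen : rLen r ek = t ^ r := by rw [rLen, abs_of_nonneg htnn]
  -- κ t ≤ c t^r
  have hpow : κ / c ≤ t ^ (r - 1) := by
    calc κ / c = ((κ / c) ^ (1 / (r - 1))) ^ (r - 1) := by
          rw [← Real.rpow_mul (div_nonneg hκ hc.le), one_div_mul_cancel hq.ne', Real.rpow_one]
      _ ≤ t ^ (r - 1) := Real.rpow_le_rpow ht0 htge hq.le
  have hkey : κ * t ≤ c * t ^ r := by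
    have hr1 : t ^ r = t ^ (r - 1) * t := by
      rcases htnn.eq_or_lt with h0 | hpos
      · rw [← h0, Real.zero_rpow (by linarith : r ≠ 0)]; ring
      · have : t ^ r = t ^ ((r - 1) + 1) := by rw [sub_add_cancel]
        rw [this, Real.rpow_add hpos, Real.rpow_one]
    rw [hr1]
    have h1 : κ ≤ c * t ^ (r - 1) := by
      have := mul_le_mul_of_nonneg_left hpow hc.le
      rwa [mul_div_cancel₀ _ hc.ne'] at this
    calc κ * t ≤ (c * t ^ (r - 1)) * t := mul_le_mul_of_nonneg_right h1 htnn
      _ = c * (t ^ (r - 1) * t) := by ring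
  -- e^{−c r} ≤ e^{−κt} = e_k^κ
  rw [hrLen, Real.rpow_def_of_pos hek, show Real.log ek * κ = -(κ * t) by rw [ht, Real.log_inv]; ring]
  exact Real.exp_le_exp.mpr (by linarith)

end Walk

/-! ## §2  The scale (2.2) against `x = L^kε` -/

section Scales

variable {L ε e : ℝ} {d k : ℕ}

/-- (2.2): `e_k = (L^kε)^{(4−d)/2}e > 0` for `L^kε > 0`, `e > 0`. [cite: BalabanImbrieJaffe1988, (2.2) p.260] -/
theorem eK_pos (hs : 0 < L ^ k * ε) (he : 0 < e) : 0 < eK L ε e d k := by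
  unfold eK; exact mul_pos (Real.rpow_pos_of_pos hs _) he

/-- in dimension `d ≤ 3`, with `e ≤ 1` and `L^kε ≤ 1`: `e_k ≤ (L^kε)^{1/2}` (since `(4−d)/2 ≥ 1/2`).
[cite: BalabanImbrieJaffe1988, (2.2) p.260] -/
theorem eK_le_sqrt (hs : 0 < L ^ k * ε) (hs1 : L ^ k * ε ≤ 1) (he1 : e ≤ 1) (hd : d ≤ 3) :
    eK L ε e d k ≤ (L ^ k * ε) ^ (1 / 2 : ℝ) := by
  unfold eK
  have hexp : (1 / 2 : ℝ) ≤ (4 - (d : ℝ)) / 2 := by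
    have : (d : ℝ) ≤ 3 := by exact_mod_cast hd
    linarith
  calc (L ^ k * ε) ^ ((4 - (d : ℝ)) / 2) * e ≤ (L ^ k * ε) ^ ((4 - (d : ℝ)) / 2) * 1 :=
        mul_le_mul_of_nonneg_left he1 (Real.rpow_nonneg hs.le _)
    _ ≤ (L ^ k * ε) ^ (1 / 2 : ℝ) := by
        rw [mul_one]; exact Real.rpow_le_rpow_of_exponent_ge hs hs1 hexp

/-- hence `e_k^κ ≤ (L^kε)^{κ/2}` for `κ ≥ 0`. [cite: BalabanImbrieJaffe1988, (2.2) p.260] -/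
theorem eK_rpow_le (hs : 0 < L ^ k * ε) (hs1 : L ^ k * ε ≤ 1) (he : 0 < e) (he1 : e ≤ 1) (hd : d ≤ 3) {κ : ℝ}
    (hκ : 0 ≤ κ) : eK L ε e d k ^ κ ≤ (L ^ k * ε) ^ (κ / 2) := by
  calc eK L ε e d k ^ κ ≤ ((L ^ k * ε) ^ (1 / 2 : ℝ)) ^ κ :=
        Real.rpow_le_rpow (eK_pos hs he).le (eK_le_sqrt hs hs1 he1 hd) hκ
    _ = (L ^ k * ε) ^ (κ / 2) := by rw [← Real.rpow_mul hs.le]; congr 1; ring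

/-- and `e_k ≤ exp(−T)` as soon as `L^kε ≤ exp(−2T)`. [cite: BalabanImbrieJaffe1988, (2.2) p.260] -/
theorem eK_le_exp_neg (hs : 0 < L ^ k * ε) (hs1 : L ^ k * ε ≤ 1) (he1 : e ≤ 1) (hd : d ≤ 3) {T : ℝ}
    (hT : L ^ k * ε ≤ Real.exp (-(2 * T))) : eK L ε e d k ≤ Real.exp (-T) := by
  calc eK L ε e d k ≤ (L ^ k * ε) ^ (1 / 2 : ℝ) := eK_le_sqrt hs hs1 he1 hd
    _ ≤ (Real.exp (-(2 * T))) ^ (1 / 2 : ℝ) := Real.rpow_le_rpow hs.le hT (by norm_num)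
    _ = Real.exp (-T) := by rw [← Real.exp_mul]; congr 1; ring

/-! ## §3  The two "extremely small factors" against the vertex power `θ_v^M = (K_v (L^kε)^a)^M` -/

/-- **THE LONG-COVARIANCE FACTOR IS BELOW THE VERTEX POWER** — p. 310 *"The others, localized in region X, have a factor
of e^{−cr(e_k)|X|}"* with (2.3) `r > 1` against p. 309's per-vertex `e^β(L^kε/ε₀)^{1/4−α} = K_v (L^kε)^a`: for every `M`,
`K_w e^{−c r(e_k)} ≤ (K_v (L^kε)^a)^M` as soon as `L^kε ≤ exp(−2(2(aM+1)/c)^{1/(r−1)})` and `K_w·L^kε ≤ K_v^M`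
(`d ≤ 3`, `e ≤ 1`, `L^kε ≤ 1`, `a ≥ 0`). [cite: BalabanImbrieJaffe1988, §5.14 p.310; (2.2)-(2.3) p.260; p.309] -/
theorem walkFactor_le_vertexPow (hs : 0 < L ^ k * ε) (hs1 : L ^ k * ε ≤ 1) (he : 0 < e) (he1 : e ≤ 1) (hd : d ≤ 3)
    {c r a Kv Kw : ℝ} {M : ℕ} (hc : 0 < c) (hr : 1 < r) (ha : 0 ≤ a) (hKw : 0 ≤ Kw)
    (hT : L ^ k * ε ≤ Real.exp (-(2 * ((2 * (a * M + 1)) / c) ^ (1 / (r - 1)))))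
    (hK : Kw * (L ^ k * ε) ≤ Kv ^ M) :
    Kw * Real.exp (-(c * rLen r (eK L ε e d k))) ≤ (Kv * (L ^ k * ε) ^ a) ^ M := by
  have hκ : 0 ≤ 2 * (a * M + 1) := by positivity
  have h1 : Real.exp (-(c * rLen r (eK L ε e d k))) ≤ eK L ε e d k ^ (2 * (a * M + 1)) :=
    exp_neg_mul_rLen_le_rpow hc hκ hr (eK_pos hs he) (eK_le_exp_neg hs hs1 he1 hd hT)
  have h2 : eK L ε e d k ^ (2 * (a * M + 1)) ≤ (L ^ k * ε) ^ (a * M) * (L ^ k * ε) :=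
    calc eK L ε e d k ^ (2 * (a * M + 1)) ≤ (L ^ k * ε) ^ (2 * (a * M + 1) / 2) := eK_rpow_le hs hs1 he he1 hd hκ
      _ = (L ^ k * ε) ^ (a * M) * (L ^ k * ε) := by
          rw [show 2 * (a * (M : ℝ) + 1) / 2 = a * M + 1 by ring, Real.rpow_add hs, Real.rpow_one]
  calc Kw * Real.exp (-(c * rLen r (eK L ε e d k))) ≤ Kw * ((L ^ k * ε) ^ (a * M) * (L ^ k * ε)) :=
        mul_le_mul_of_nonneg_left (h1.trans h2) hKw
    _ = (Kw * (L ^ k * ε)) * (L ^ k * ε) ^ (a * M) := by ring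
    _ ≤ Kv ^ M * (L ^ k * ε) ^ (a * M) := mul_le_mul_of_nonneg_right hK (Real.rpow_nonneg hs.le _)
    _ = (Kv * (L ^ k * ε) ^ a) ^ M := by
        rw [mul_pow, ← Real.rpow_natCast ((L ^ k * ε) ^ a), ← Real.rpow_mul hs.le]

/-- **THE `χ′`-FACTOR IS BELOW THE VERTEX POWER** — p. 309 *"After integration over A^{(k)}, we obtain factors
ct^{−n}e^{−cp(te_k)²} ≦ (e^β(L^kε/ε₀)^{1/4−α})^n"* and p. 278 *"exp(−cp(e_k)²) ≦ e_k^κ, for any κ"* (`p > 1/2`,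
`BIJ88Claim279PkLower.exp_neg_mul_pLog_sq_le_rpow`): for every `M`, `K_η e^{−c p(e_k)²} ≤ (K_v (L^kε)^a)^M` as soon as
`L^kε ≤ exp(−2(2(aM+1)/c)^{1/(2p−1)})` and `K_η·L^kε ≤ K_v^M`.
[cite: BalabanImbrieJaffe1988, §5.14 p.309; (5.2.2) p.278; (2.2) p.260; (2.33) p.263] -/
theorem chiFactor_le_vertexPow (hs : 0 < L ^ k * ε) (hs1 : L ^ k * ε ≤ 1) (he : 0 < e) (he1 : e ≤ 1) (hd : d ≤ 3)
    {c p a Kv Kη : ℝ} {M : ℕ} (hc : 0 < c) (hp : 1 / 2 < p) (ha : 0 ≤ a) (hKη : 0 ≤ Kη)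
    (hT : L ^ k * ε ≤ Real.exp (-(2 * ((2 * (a * M + 1)) / c) ^ (1 / (2 * p - 1)))))
    (hK : Kη * (L ^ k * ε) ≤ Kv ^ M) :
    Kη * Real.exp (-(c * pLog p (eK L ε e d k) ^ 2)) ≤ (Kv * (L ^ k * ε) ^ a) ^ M := by
  have hκ : 0 ≤ 2 * (a * M + 1) := by positivity
  have h1 : Real.exp (-(c * pLog p (eK L ε e d k) ^ 2)) ≤ eK L ε e d k ^ (2 * (a * M + 1)) :=
    exp_neg_mul_pLog_sq_le_rpow hc hκ hp (eK_pos hs he) (eK_le_exp_neg hs hs1 he1 hd hT)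
  have h2 : eK L ε e d k ^ (2 * (a * M + 1)) ≤ (L ^ k * ε) ^ (a * M) * (L ^ k * ε) :=
    calc eK L ε e d k ^ (2 * (a * M + 1)) ≤ (L ^ k * ε) ^ (2 * (a * M + 1) / 2) := eK_rpow_le hs hs1 he he1 hd hκ
      _ = (L ^ k * ε) ^ (a * M) * (L ^ k * ε) := by
          rw [show 2 * (a * (M : ℝ) + 1) / 2 = a * M + 1 by ring, Real.rpow_add hs, Real.rpow_one]
  calc Kη * Real.exp (-(c * pLog p (eK L ε e d k) ^ 2)) ≤ Kη * ((L ^ k * ε) ^ (a * M) * (L ^ k * ε)) :=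
        mul_le_mul_of_nonneg_left (h1.trans h2) hKη
    _ = (Kη * (L ^ k * ε)) * (L ^ k * ε) ^ (a * M) := by ring
    _ ≤ Kv ^ M * (L ^ k * ε) ^ (a * M) := mul_le_mul_of_nonneg_right hK (Real.rpow_nonneg hs.le _)
    _ = (Kv * (L ^ k * ε) ^ a) ^ M := by
        rw [mul_pow, ← Real.rpow_natCast ((L ^ k * ε) ^ a), ← Real.rpow_mul hs.le]

/-- the logarithmic scale grows under the interpolation: `p(te_k) ≥ p(e_k)` for `0 < t ≤ 1`, `0 < e_k ≤ 1`, `p ≥ 0`.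
[cite: BalabanImbrieJaffe1988, §5.14 p.309; (2.33) p.263] -/
theorem pLog_le_pLog_mul_left {t ek p : ℝ} (ht : 0 < t) (ht1 : t ≤ 1) (hek : 0 < ek) (hek1 : ek ≤ 1) (hp : 0 ≤ p) :
    pLog p ek ≤ pLog p (t * ek) := by
  unfold pLog
  have h0 : 0 ≤ Real.log ek⁻¹ := by
    rw [Real.log_inv]; exact neg_nonneg.mpr (Real.log_nonpos hek.le hek1)
  have h1 : Real.log ek⁻¹ ≤ Real.log (t * ek)⁻¹ := by
    rw [Real.log_inv, Real.log_inv, Real.log_mul ht.ne' hek.ne', neg_add]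
    have : Real.log t ≤ 0 := Real.log_nonpos ht.le ht1
    linarith
  rw [abs_of_nonneg h0, abs_of_nonneg (h0.trans h1)]
  exact Real.rpow_le_rpow h0 h1 hp

/-- hence the `χ′`-factor bound is UNIFORM in the interpolation parameter: `e^{−c p(te_k)²} ≤ e^{−c p(e_k)²}` for
`0 < t ≤ 1` (print's `t^{−n}` belongs to the `t`-integrals, not modelled). [cite: BalabanImbrieJaffe1988, §5.14 p.309] -/
theorem chiFactor_uniform_in_t {t ek p c : ℝ} (ht : 0 < t) (ht1 : t ≤ 1) (hek : 0 < ek) (hek1 : ek ≤ 1) (hp : 0 ≤ p)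
    (hc : 0 ≤ c) : Real.exp (-(c * pLog p (t * ek) ^ 2)) ≤ Real.exp (-(c * pLog p ek ^ 2)) := by
  have h0 : 0 ≤ pLog p ek := by unfold pLog; exact Real.rpow_nonneg (abs_nonneg _) _
  have h := pow_le_pow_left₀ h0 (pLog_le_pLog_mul_left ht ht1 hek hek1 hp) 2
  exact Real.exp_le_exp.mpr (neg_le_neg (mul_le_mul_of_nonneg_left h hc))

/-- the four thresholds of §3 hold for ALL SMALL `L^kε` (any `T_w`, `T_η`, `K_w`, `K_η`; `K_v > 0`).
[cite: BalabanImbrieJaffe1988, §5.14 p.312; p.309; p.310] -/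
theorem eventually_thresholds {Tw Tη Kw Kη Kv : ℝ} {M : ℕ} (hKv : 0 < Kv) :
    ∀ᶠ s in 𝓝[>] (0 : ℝ), s ≤ Real.exp (-Tw) ∧ Kw * s ≤ Kv ^ M ∧ s ≤ Real.exp (-Tη) ∧ Kη * s ≤ Kv ^ M := by
  have hKM : 0 < Kv ^ M := pow_pos hKv M
  have h1 : ∀ᶠ s in 𝓝 (0 : ℝ), s ≤ Real.exp (-Tw) := eventually_le_nhds (Real.exp_pos _)
  have h3 : ∀ᶠ s in 𝓝 (0 : ℝ), s ≤ Real.exp (-Tη) := eventually_le_nhds (Real.exp_pos _)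
  have hlin : ∀ K : ℝ, ∀ᶠ s in 𝓝 (0 : ℝ), K * s ≤ Kv ^ M := fun K => by
    have ht : Tendsto (fun s : ℝ => K * s) (𝓝 0) (𝓝 (K * 0)) := tendsto_id.const_mul K
    rw [mul_zero] at ht
    exact ht.eventually (eventually_le_nhds hKM)
  exact (eventually_nhdsWithin_of_eventually_nhds ((h1.and (hlin Kw)).and (h3.and (hlin Kη)))).mono
    fun s h => ⟨h.1.1, h.1.2, h.2.1, h.2.2⟩

end Scales

/-! ## §4  The head theorem in print's currency with both sentences discharged -/

section Law

variable {ι : Type} [Fintype ι] {κ : Type} [LinearOrder κ] {P : Type} [Fintype P] {β : Type} [DecidableEq β]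
variable {α I : Type} [Fintype α] [DecidableEq α] [Fintype I] [DecidableEq I]
  {blk : α → I} {Δ : Matrix α α ℝ} {ℱ : α → ℝ} {W : Finset I}

/-- **THE HEAD THEOREM OF ROW C2.Claim@312 IN PRINT'S CURRENCY, THE TWO "EXTREMELY SMALL FACTORS" SENTENCES DERIVED**:
`BIJ88WalkRemainderBeatCurrency312.ineq312_remainder_bdry_currency` at `x := L^kε` with the long-covariance letter
`θ_w := K_w e^{−c_w r(e_k)}` (p. 310) and the `χ′` letter `η_χ := K_η e^{−c_η p(e_k)²}` (p. 309), `e_k = (L^kε)^{(4−d)/2}e`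
((2.2)), `r(e) = |log e⁻¹|^r`, `r > 1` ((2.3)), `p(e) = |log e⁻¹|^{p₀}`, `p₀ > 1/2` ((2.33)); its hypotheses `η_χ ≤ θ_v^M`,
`θ_w ≤ θ_v^M` are REPLACED by the thresholds `L^kε ≤ exp(−2(2(aM+1)/c_w)^{1/(r−1)})`, `K_w L^kε ≤ K_v^M`,
`L^kε ≤ exp(−2(2(aM+1)/c_η)^{1/(2p₀−1)})`, `K_η L^kε ≤ K_v^M` (with `d ≤ 3`, `e ≤ 1`, `a ≥ 0`).  Conclusion verbatim the
head's. [cite: BalabanImbrieJaffe1988, §5.14 p.312 (estimate preceding (5.14.5)); p.309; p.310; (2.2)-(2.3) p.260] -/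
theorem ineq312_remainder_bdry_scales [Fintype κ] (hPD : (prec blk Δ W (corner ℝ W)).PosDef)
    {Cov : P → Matrix {x : α // blk x ∈ W} {x : α // blk x ∈ W} ℝ} {trig : P → Bool} {c : ι → ℝ}
    {legs : ι → List ({x : α // blk x ∈ W} → ℝ)} {obs : κ → List ({x : α // blk x ∈ W} → ℝ)} {M : ℕ}
    {χ : ({x : α // blk x ∈ W} → ℝ) → ℝ} {oc : κ → Finset β} {vc : ι → Finset β} {reg : P → Finset β}
    {Dir : Set ({x : α // blk x ∈ W} → ℝ)} {B' ρ : P → ℝ} {cV : ι → ℝ} {θ ρ₀ Kχ : ℝ} {Λ : Finset κ → ℝ}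
    {N₀ : ℕ} {L ε e : ℝ} {d k : ℕ} {a mB Kv KB cw r Kw cη p₀ Kη : ℝ}
    (hx : 0 < L ^ k * ε) (hx1 : L ^ k * ε ≤ 1) (he : 0 < e) (he1 : e ≤ 1) (hd : d ≤ 3) (ha : 0 ≤ a)
    (hKv : 0 < Kv) (hKB : 1 ≤ KB) (hmB : 0 ≤ mB) (hθv1 : Kv * (L ^ k * ε) ^ a ≤ 1)
    (hcw : 0 < cw) (hr : 1 < r) (hKw : 0 < Kw) (hcη : 0 < cη) (hp₀ : 1 / 2 < p₀) (hKη : 0 ≤ Kη)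
    (hθ0 : 0 < θ) (hθ1 : θ ≤ 1) (hB0 : ∀ p, 0 ≤ B' p) (hρ : ∀ p, 0 ≤ ρ p) (hcV0 : ∀ m, 0 ≤ cV m)
    (hB : ∀ p, ∀ u ∈ Dir, ∀ w ∈ Dir, |(Cov p *ᵥ u) ⬝ᵥ w| ≤ B' p * ρ p)
    (hBf : ∀ p, ∀ u ∈ Dir, |(Cov p *ᵥ u) ⬝ᵥ src blk ℱ W| ≤ B' p * ρ p)
    (hBz : ∀ p, ∀ u ∈ Dir, ‖Cov p *ᵥ u‖ ≤ B' p * ρ p)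
    (hcV : ∀ m, |c m| ≤ cV m) (hobs : ∀ j, ∀ w ∈ obs j, w ∈ Dir) (hlegs : ∀ m, ∀ w ∈ legs m, w ∈ Dir)
    (hloc : ∀ p, trig p = false → B' p ≤ KB * (L ^ k * ε) ^ (-mB) ∧ reg p = ∅)
    (hwalk : ∀ p, trig p = true → B' p ≤ Kw * Real.exp (-(cw * rLen r (eK L ε e d k))) * θ ^ (reg p).card)
    (hvert : ∀ m, cV m * (KB * (L ^ k * ε) ^ (-mB)) ^ (legs m).length ≤ Kv * (L ^ k * ε) ^ a * θ ^ (vc m).card)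
    (hρ₀0 : 0 ≤ ρ₀) (hρ₀ : ∀ u ∈ Dir, (∑ p ∈ univ.filter (fun p => Cov p *ᵥ u ≠ 0), ρ p) ≤ ρ₀)
    (hN : ∀ p, ∀ u ∈ Dir,
      (∑ m, ((range (legs m).length).filter fun j => (Cov p *ᵥ u) ⬝ᵥ (legs m).getD j 0 ≠ 0).card) ≤ N₀)
    (hKχ : 0 ≤ Kχ) (hΛ : ∀ O, 0 ≤ Λ O)
    (hE : ∀ O : Finset κ, ∀ t ∈ expand Cov trig (src blk ℱ W) c legs obs M 0 O, t.consts = 0 →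
      |∫ φ, ((t.groups.map fun h => (h.pend : Multiset _)).sum.map fun w => φ ⬝ᵥ w).prod
          * (dlist t.dirs χ φ * vexp c legs φ) ∂(fieldLaw blk Δ ℱ W)|
        ≤ Kχ * (t.dirs.map fun z => Kη * Real.exp (-(cη * pLog p₀ (eK L ε e d k) ^ 2)) * ‖z‖).prod * Λ O)
    (bdry : Finset κ)
    (hM : mB * (∑ j ∈ univ.filter (fun j => j ∉ bdry), (obs j).length : ℕ) < a * M)
    (hxle : L ^ k * ε ≤ (Kv ^ M * KB ^ (∑ j ∈ univ.filter (fun j => j ∉ bdry), (obs j).length)) ^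
      (-(1 / (a * M - mB * (∑ j ∈ univ.filter (fun j => j ∉ bdry), (obs j).length : ℕ)))))
    (hTw : L ^ k * ε ≤ Real.exp (-(2 * ((2 * (a * M + 1)) / cw) ^ (1 / (r - 1)))))
    (hKw' : Kw * (L ^ k * ε) ≤ Kv ^ M)
    (hTη : L ^ k * ε ≤ Real.exp (-(2 * ((2 * (a * M + 1)) / cη) ^ (1 / (2 * p₀ - 1)))))
    (hKη' : Kη * (L ^ k * ε) ≤ Kv ^ M) :
    BIJ88Sect5StatementsPart4.Ineq312 (remSys κ β)
      (fun OX => remAt (prec blk Δ W (corner ℝ W)) Cov trig (src blk ℱ W) c legs obs M χ oc vc reg [] 0 OX.1 OX.2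
        / ∫ φ, weight (prec blk Δ W (corner ℝ W)) φ * source (src blk ℱ W) φ)
      (fun OX => Kχ * Λ OX.1 * (max 1 (ρ₀ * ((phi0 legs obs M OX.1 + N₀ : ℕ) : ℝ))) ^ phi0 legs obs M OX.1)
      (fun OX => ∏ j ∈ OX.1.filter (fun j => j ∈ bdry), (KB * (L ^ k * ε) ^ (-mB)) ^ (obs j).length)
      (fun OX => nfreeOf oc OX.2) θ 1 :=
  ineq312_remainder_bdry_currency (oc := oc) (vc := vc) (reg := reg) (χ := χ) hPD hx hx1 hKv hKB hmB hθv1 hθ0 hθ1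
    hB0 hρ hcV0 (mul_nonneg hKη (Real.exp_pos _).le) (mul_pos hKw (Real.exp_pos _)) hB hBf hBz hcV hobs hlegs hloc
    hwalk hvert hρ₀0 hρ₀ hN hKχ hΛ hE bdry hM hxle (chiFactor_le_vertexPow hx hx1 he he1 hd hcη hp₀ ha hKη hTη hKη')
    (walkFactor_le_vertexPow hx hx1 he he1 hd hcw hr ha hKw.le hTw hKw')

end Law

end Literature.MathematicalPhysics.QuantumFieldTheory.BalabanImbrieJaffe1984to88.BIJ88WalkSmallFactorScales312

end
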